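import Summits.CriticalPhenomena.PercolationContinuityZ3.Theorems.PercNearOneGluingNoHeavyLowerTailSahiTransportJRTables
import Summits.CriticalPhenomena.PercolationContinuityZ3.Theorems.PercNearOneGluingNoHeavyLowerTailSahiTransportCert
import Summits.CriticalPhenomena.PercolationContinuityZ3.Theorems.PercNearOneGluingNoHeavyLowerTailSahiC3CubeEvents

/-!
# `NoHeavyLowerTail` (crux stmt-CriticalPhenomena-4575), Sahi / Kahn positivity: parameter-free transport certificates — SOUNDNESS (I), the dictionary

Support file (cell `prim-l12`, seat P3, gen 5; `--supports stmt-CriticalPhenomena-4575`).  No `sorry`, no named facts, standard axioms.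
Part of the SOUNDNESS of the parameter-free transport-certificate check `SahiTransportJR.checkTab` (`…SahiTransportJRTables`): if the digit test of
every capacity row and every (TC) row of a coefficient table `ct` for the pattern event with bitmask `M` passes, then at EVERY parameter vector
`q ∈ [0,1]^m` the scaled measure `σ_q(T) = (1/DEN)·Σ_{η ∉ H ∋ ζ} ct[η][ζ][code T]·w_q(η)w_q(ζ)` satisfies (o), (a), (TC) of the reduced certificate,
hence (Strassen) a `SahiTransportCert.TransportCert` exists and Kahn's Conjecture 5 / Sahi's `C₃` holds for that junta first slot with the other
two slots arbitrary (`…SahiTransportCert.sahiE_three_nonneg_of_transportCert`).  Chain: `…JRDict` (dictionary `Set (Fin m)` ↔ bitmasks for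
general `m`, structural facts of a table) → `…JRMeasure` (the scaled measure: mass, support, the stochastic-order condition (o)) → `…JRRows`
(capacity and (TC) rows: certificate numbers = `cubicZ` of explicit term families, digit test ⇒ row inequality) → `…JRSound` (the certificate and
`sahiE_three_nonneg_of_checkTab`). [this work]

This file: list sums over `pts` as indicator sums, what `structTab` says (`TabFacts`), codes of patterns for general `m` (`code`, `pt_code`,
`code_pt`, `sum_eq_sum_range`), the product weight and `pr` as multilinear polynomials of bitmask tables (`mlM`, `pr_eq_mlM`, tables of `P`,
`Pᶜ` and intersections, point masks `2^t`).
-/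

noncomputable section

open scoped Classical

namespace Summit.CriticalPhenomena.PercolationContinuityZ3.Theorems.SahiTransportJR

open Finset SahiHittingSlot SahiTransportCert SahiC3Cube SahiTransportCheck OneCutCert CovTransferCert Literature.Combinatorics.Sahi2008
open Literature.Probability.Percolation (DeterminedBy)
open Literature.Probability.Percolation.BHK2006 (weight ind_inter)
open Literature.Probability.Percolation.DecisionTree (ind ind_of_mem ind_of_not_mem ind_nonneg)

variable {m : ℕ}

/-! ### Part A: list sums, structure extraction, the pattern-cube dictionary for general `m` -/

/-! #### List sums over `pts` as indicator sums -/

/-- `Σ_{i<n}` as a list sum over `List.range`. [this work] -/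
theorem sum_map_range {α : Type*} [AddCommMonoid α] (f : ℕ → α) (n : ℕ) :
    ((List.range n).map f).sum = ∑ i ∈ Finset.range n, f i := by
  induction n with
  | zero => simp
  | succ n ih => rw [List.range_succ, List.map_append, List.sum_append, ih, Finset.sum_range_succ]; simp

/-- Filtered list sums are indicator sums. [this work] -/
theorem sum_map_filter_eq {α : Type*} [AddCommMonoid α] (l : List ℕ) (p : ℕ → Bool) (f : ℕ → α) :
    ((l.filter p).map f).sum = (l.map fun i => if p i = true then f i else 0).sum := by
  induction l with
  | nil => simp
  | cons a l ih =>
    rw [List.filter_cons]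
    by_cases h : p a = true
    · simp [h, ih]
    · simp [h, ih]

/-- Sums over the points of a bitmask as indicator sums over `range (2^m)`. [this work] -/
theorem sum_pts (m M : ℕ) (f : ℕ → ℤ) :
    ((pts m M).map f).sum = ∑ i ∈ Finset.range (2 ^ m), if M.testBit i = true then f i else 0 := by
  unfold pts; rw [sum_map_filter_eq, sum_map_range]

/-- Membership in `pts`. [this work] -/
theorem mem_pts {m M x : ℕ} : x ∈ pts m M ↔ x < 2 ^ m ∧ M.testBit x = true := by
  unfold pts; simp [List.mem_filter, List.mem_range]

/-- `psub` is `⊆` on coordinate sets. [this work] -/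
theorem psub_iff {x y : ℕ} : psub x y = true ↔ ∀ i, x.testBit i = true → y.testBit i = true := by
  unfold psub
  rw [beq_iff_eq]
  constructor
  · intro h i hi
    have := congrArg (fun n => n.testBit i) h
    simp only [Nat.testBit_land] at this
    rw [hi, Bool.true_and] at this
    exact this
  · intro h
    apply Nat.eq_of_testBit_eq
    intro i
    rw [Nat.testBit_land]
    cases hx : x.testBit i
    · simp
    · simp [h i hx]

/-- Bits of the complement mask below `2^m`. [this work] -/
theorem testBit_cpl {m M x : ℕ} (hx : x < 2 ^ m) : (cpl m M).testBit x = !(M.testBit x) := by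
  unfold cpl fullN
  rw [Nat.testBit_xor, Nat.testBit_two_pow_sub_one, decide_eq_true hx]
  cases M.testBit x <;> rfl

/-! #### What the structural test says -/

/-- The structural facts recorded by `structTab`. [this work] -/
structure TabFacts (m M : ℕ) (ct : Tab) : Prop where
  nonneg : ∀ η, η < 2 ^ m → M.testBit η = false → ∀ ζ, ζ < 2 ^ m → M.testBit ζ = true → ∀ T, T < 2 ^ m → 0 ≤ get3 ct η ζ T
  supp : ∀ η, η < 2 ^ m → M.testBit η = false → ∀ ζ, ζ < 2 ^ m → M.testBit ζ = true → ∀ T, T < 2 ^ m →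
    get3 ct η ζ T ≠ 0 → psub η T = true ∧ M.testBit T = true
  rowsum : ∀ η, η < 2 ^ m → M.testBit η = false → ∀ ζ, ζ < 2 ^ m → M.testBit ζ = true →
    ∑ T ∈ Finset.range (2 ^ m), get3 ct η ζ T = (DEN : ℤ)

/-- `structTab = true` yields the structural facts. [this work] -/
theorem tabFacts_of_structTab {m M : ℕ} {ct : Tab} (h : structTab m M ct = true) : TabFacts m M ct := by
  unfold structTab at h
  simp only [List.all_eq_true, Bool.and_eq_true, decide_eq_true_eq, Bool.or_eq_true, List.mem_range] at h
  have key : ∀ η, η < 2 ^ m → M.testBit η = false → ∀ ζ, ζ < 2 ^ m → M.testBit ζ = true →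
      (∀ T, T < 2 ^ m → 0 ≤ get3 ct η ζ T ∧ (get3 ct η ζ T = 0 ∨ (psub η T = true ∧ M.testBit T = true))) ∧
        ((List.range (2 ^ m)).map fun T => get3 ct η ζ T).sum = (DEN : ℤ) := by
    intro η hη hηD ζ hζ hζH
    have hηm : η ∈ pts m (cpl m M) := mem_pts.2 ⟨hη, by rw [testBit_cpl hη, hηD]; rfl⟩
    have hζm : ζ ∈ pts m M := mem_pts.2 ⟨hζ, hζH⟩
    exact h η hηm ζ hζm
  refine ⟨fun η hη hD ζ hζ hH T hT => ((key η hη hD ζ hζ hH).1 T hT).1, fun η hη hD ζ hζ hH T hT hne => ?_, fun η hη hD ζ hζ hH => ?_⟩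
  · rcases ((key η hη hD ζ hζ hH).1 T hT).2 with h0 | h1
    · exact (hne h0).elim
    · exact h1
  · rw [← sum_map_range]; exact (key η hη hD ζ hζ hH).2

/-! #### Codes of patterns (general `m`) -/


/-- The bit pattern of `S`. [this work] -/
def bits (S : Set (Fin m)) : Fin m → Bool := fun i => decide (i ∈ S)

/-- The code (point number `< 2^m`) of a pattern. [this work] -/
def code (S : Set (Fin m)) : ℕ := enc2 (bits S)

/-- `code S < 2^m`. [this work] -/
theorem code_lt (S : Set (Fin m)) : code S < 2 ^ m := enc2_lt (bits S)

/-- Decoding: `pt m (code S) = S`. [this work] -/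
theorem pt_code (S : Set (Fin m)) : pt m (code S) = S := by
  rw [code, pt_enc2]; ext i; simp [bits]

/-- The bits of a code. [this work] -/
theorem testBit_code (S : Set (Fin m)) (i : Fin m) : (code S).testBit i = decide (i ∈ S) := by
  rw [code, OneCutCert.testBit_enc2]; rfl

/-- Encoding: `code (pt m x) = x` for `x < 2^m`. [this work] -/
theorem code_pt {x : ℕ} (hx : x < 2 ^ m) : code (pt m x) = x := by
  apply Nat.eq_of_testBit_eq
  intro i
  rw [code, SahiC3Cube.testBit_enc2]
  split_ifs with hi
  · simp [bits, pt]
  · symm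
    apply Nat.testBit_eq_false_of_lt
    exact lt_of_lt_of_le hx (Nat.pow_le_pow_right (by norm_num) (not_lt.1 hi))

/-- Sums over the pattern cube are sums over the codes. [this work] -/
theorem sum_eq_sum_range (F : Set (Fin m) → ℝ) : ∑ S, F S = ∑ j ∈ Finset.range (2 ^ m), F (pt m j) :=
  Finset.sum_nbij' (fun S => code S) (fun j => pt m j) (fun S _ => Finset.mem_range.2 (code_lt S)) (fun j _ => Finset.mem_univ _)
    (fun S _ => pt_code S) (fun j hj => code_pt (Finset.mem_range.1 hj)) (fun S _ => by rw [pt_code])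

/-- `S ⊆ T` from `psub` of the codes. [this work] -/
theorem subset_of_psub {S T : Set (Fin m)} (h : psub (code S) (code T) = true) : S ⊆ T := by
  intro i hi
  have := psub_iff.1 h i (by rw [testBit_code]; exact decide_eq_true hi)
  rw [testBit_code] at this
  exact of_decide_eq_true this

/-- Membership in an event through the code. [this work] -/
theorem mem_iff_testBit_encA (P : Set (Set (Fin m))) (S : Set (Fin m)) : S ∈ P ↔ (encA m P).testBit (code S) = true := by
  rw [testBit_encA, pt_code]
  simp [code_lt S]

/-! #### Multilinear polynomials of bitmask tables (general `m`) -/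

/-- The parameters as a real point. [this work] -/
def xq (q : Fin m → unitInterval) : Fin m → ℝ := fun i => (q i : ℝ)

/-- `xq q ∈ [0,1]^m`. [this work] -/
theorem inCube_xq (q : Fin m → unitInterval) : InCube (xq q) := fun i => ⟨(q i).2.1, (q i).2.2⟩

/-- `w(T)` as a polynomial: `ML` of the bitmask table. [this work] -/
noncomputable def mlM (m T : ℕ) (x : Fin m → ℝ) : ℝ := ML (tabR m T) x

/-- `mlM ≥ 0` on the cube. [this work] -/
theorem mlM_nonneg (T : ℕ) {x : Fin m → ℝ} (hx : InCube x) : 0 ≤ mlM m T x := by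
  unfold mlM ML
  exact Finset.sum_nonneg fun g _ => mul_nonneg (by unfold tabR; rw [tabZ_apply]; split_ifs <;> simp) (mono_nonneg hx g)

/-- `pr q 𝒴 = mlM (encA 𝒴)`. [this work] -/
theorem pr_eq_mlM (q : Fin m → unitInterval) (𝒴 : Set (Set (Fin m))) : pr q 𝒴 = mlM m (encA m 𝒴) (xq q) := by
  rw [pr, ex_bernoulliWeight_ind, real_eq_ML_cube]; rfl

/-- Equal tables, equal polynomials. [this work] -/
theorem mlM_congr {A B : ℕ} (h : tabR m A = tabR m B) (x : Fin m → ℝ) : mlM m A x = mlM m B x := by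
  unfold mlM; rw [h]

/-- The table of `encA P` is the table of any mask with the same low bits. [this work] -/
theorem tabR_encA_eq {P : Set (Set (Fin m))} {M : ℕ} (h : ∀ x, x < 2 ^ m → (M.testBit x = true ↔ pt m x ∈ P)) :
    tabR m (encA m P) = tabR m M := by
  funext g
  simp only [tabR]
  rw [tabZ_encA, tabZ_apply, ← pt_enc2]
  by_cases hP : pt m (enc2 g) ∈ P
  · rw [if_pos hP, if_pos ((h _ (enc2_lt g)).2 hP)]
  · rw [if_neg hP, if_neg (fun hM => hP ((h _ (enc2_lt g)).1 hM))]

/-- Tables of intersections with `P` and with `Pᶜ`. [this work] -/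
theorem tabR_encA_inter_eq {P : Set (Set (Fin m))} {M : ℕ} (h : ∀ x, x < 2 ^ m → (M.testBit x = true ↔ pt m x ∈ P))
    (𝒴 : Set (Set (Fin m))) : tabR m (encA m (P ∩ 𝒴)) = tabR m (M &&& encA m 𝒴) ∧
      tabR m (encA m (Pᶜ ∩ 𝒴)) = tabR m (cpl m M &&& encA m 𝒴) := by
  constructor
  · rw [tabR_encA_inter, tabR_land, tabR_land, tabR_encA_eq h]
  · rw [tabR_encA_inter, tabR_land, tabR_land]
    have hc : tabR m (encA m Pᶜ) = tabR m (cpl m M) := by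
      funext g
      simp only [tabR]
      rw [tabZ_encA, tabZ_apply, testBit_cpl (enc2_lt g), ← pt_enc2]
      by_cases hP : pt m (enc2 g) ∈ P
      · rw [Set.mem_compl_iff, if_neg (not_not.2 hP), ((h _ (enc2_lt g)).2 hP)]; rfl
      · rw [Set.mem_compl_iff, if_pos hP]
        have : M.testBit (enc2 g) = false := by
          cases hb : M.testBit (enc2 g)
          · rfl
          · exact (hP ((h _ (enc2_lt g)).1 hb)).elim
        rw [this]; rfl
    rw [hc]

/-- The table of a point mask `2^t` is the indicator of the corner of `t`. [this work] -/
theorem tabZ_pow (t : ℕ) (g : Fin m → Bool) : tabZ m (2 ^ t) g = if enc2 g = t then 1 else 0 := by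
  rw [tabZ_apply, Nat.testBit_two_pow]
  by_cases h : enc2 g = t
  · subst h; simp
  · simp [h, show ¬ t = enc2 g from fun e => h e.symm]

/-- `mlM (2^t)` is the monomial of the corner `t`. [this work] -/
theorem mlM_pow (t : ℕ) (ht : t < 2 ^ m) (x : Fin m → ℝ) : mlM m (2 ^ t) x = mono x (fun i : Fin m => t.testBit i) := by
  unfold mlM ML
  rw [Finset.sum_eq_single (fun i : Fin m => t.testBit i)]
  · simp only [tabR]
    rw [tabZ_pow t]
    have : enc2 (fun i : Fin m => t.testBit i) = t := by
      have := code_pt (m := m) ht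
      unfold code bits at this
      simpa [pt] using this
    rw [if_pos this]; simp
  · intro g _ hg
    simp only [tabR]
    rw [tabZ_pow t, if_neg]
    · simp
    · intro he
      apply hg
      funext i
      have := OneCutCert.testBit_enc2 g i
      rw [he] at this
      exact this.symm
  · intro h; exact (h (Finset.mem_univ _)).elim

/-- The weight of a point pattern is the monomial of its code. [this work] -/
theorem bernoulliWeight_pt (q : Fin m → unitInterval) (j : ℕ) :
    bernoulliWeight q (pt m j) = mono (xq q) (fun i : Fin m => j.testBit i) := by
  unfold bernoulliWeight weight mono xq
  refine Finset.prod_congr rfl fun i _ => ?_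
  simp only [pt, Set.mem_setOf_eq]

/-- `w(pt t) = mlM (2^t)` at the parameters. [this work] -/
theorem bernoulliWeight_pt_eq_mlM (q : Fin m → unitInterval) {t : ℕ} (ht : t < 2 ^ m) :
    bernoulliWeight q (pt m t) = mlM m (2 ^ t) (xq q) := by
  rw [mlM_pow t ht, bernoulliWeight_pt]

end Summit.CriticalPhenomena.PercolationContinuityZ3.Theorems.SahiTransportJR
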